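/-
Copyright (c) 2026. All rights reserved.
Released under Apache 2.0 license as described in the file LICENSE.
Authors: abc-iut cell — seat abc-iut-w5-d208 (gen 2), filing the one-liner staged by seat abc-iut-w5-d053
(gen 2, `HOME/staging/w5/w5-d053/cor27/…TorsionHolds.lean.draft`) together with the unconditional form of
this seat's equality closer; proof-only, no definitions.
-/
import Literature.AnabelianGeometry.AbsoluteAnabelian.HolomorphicEllipticCuspidalizationTorsionCharacterisation
import Literature.AnabelianGeometry.AbsoluteAnabelian.AutHolomorphicSpacesLocalProofs
import HarnessLib

/-!
# [AbsTopIII] Cor 2.7 (b), sub-nodes (b).8 and (b).eq — UNCONDITIONAL forms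

S. Mochizuki, *Topics in absolute anabelian geometry III*, Cor. 2.7 (b) (kurims p.59; bib key
`MochizukiAbsTopIII2015`): "one may construct the torsion points of the elliptic curve as the points of
`𝔼^top` that lie in the complement of the image of such local morphisms of elliptic cuspidalization".

The cell's sub-DAG `plan/L4/SUBDAG-AbsTopIII-Cor-27.md` proved this at the model punctured complex torus
`𝔼 = ℂ/Φ(ℤ^ι) ∖ {0}` CONDITIONALLY on the named fact `LocalMorphismIsRCHolomorphic` ([AbsTopIII] Cor 2.3 (i),
FACT-LIST F-0074): `cuspidalTorsionPointsAreTorsion_of` (abc-iut-w5-d053, row r10 (b).8) and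
`cuspidalTorsionPoints_eq_of` / `mem_cuspidalTorsionPoints_iff_of` (abc-iut-w5-d208, row r11 (b).eq).
abc-iut-L4-t7's `AutHolomorphicSpacesLocalProofs.lean` has since PROVED Cor 2.3 (i) in the kernel
(`localMorphismIsRCHolomorphic_holds`).  This file records the resulting hypothesis-free statements:

* `cuspidalTorsionPointsAreTorsion_holds : CuspidalTorsionPointsAreTorsion` ((b).8);
* `cuspidalTorsionPoints_eq` — `cuspidalTorsionPoints 𝔼 = {x | IsOfFinAddOrder (x : T)}` ((b).eq);
* `mem_cuspidalTorsionPoints_iff` — membership form.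

After this file the named-fact inputs of the tree's Cor 2.7 are `GenusOneUniformization` (classical,
GAP-LEDGER G-L4t12g4-1) and the (b).7 closer only.  Refereed pre-IUT material; nothing here bears on the
disputed [IUTchIII] Cor. 3.12; typed ≠ endorsed.
-/

noncomputable section

namespace Literature.AnabelianGeometry.AbsoluteAnabelian

namespace HolomorphicEllipticCuspidalization

open Literature.Geometry.Kaehler (ComplexTorus)

/-- **Sub-node (b).8 of [AbsTopIII] Cor 2.7 (b) at the model, unconditionally**: every cuspidal torsion
point of the punctured complex torus is a torsion point (abc-iut-w5-d053's `cuspidalTorsionPointsAreTorsion_of`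
at the tree's proof of Cor 2.3 (i), `localMorphismIsRCHolomorphic_holds`).
[cite: MochizukiAbsTopIII2015, Corollary 2.7 (b) p.59] -/
theorem cuspidalTorsionPointsAreTorsion_holds : CuspidalTorsionPointsAreTorsion :=
  cuspidalTorsionPointsAreTorsion_of localMorphismIsRCHolomorphic_holds

/-- **[AbsTopIII] Cor 2.7 (b) at the model, as an equality, unconditionally**: the cuspidal torsion points
of the punctured complex torus `𝔼 = T ∖ {0}` are EXACTLY the points of `𝔼` of finite additive order in `T`
("one may construct the torsion points of the elliptic curve AS the points of `𝔼^top` that lie in the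
complement of the image of such local morphisms of elliptic cuspidalization").
[cite: MochizukiAbsTopIII2015, Corollary 2.7 (b) p.59] -/
theorem cuspidalTorsionPoints_eq {ι : Type} [Fintype ι] (Φ : (ι → ℝ) ≃L[ℝ] ℂ) :
    cuspidalTorsionPoints ↥(puncturedTorus Φ) =
      {x : ↥(puncturedTorus Φ) | IsOfFinAddOrder (x : ComplexTorus Φ)} :=
  cuspidalTorsionPoints_eq_of localMorphismIsRCHolomorphic_holds Φ

/-- Membership form of `cuspidalTorsionPoints_eq`: a point of the punctured complex torus is a cuspidal
torsion point iff it has finite additive order in the torus.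
[cite: MochizukiAbsTopIII2015, Corollary 2.7 (b) p.59] -/
theorem mem_cuspidalTorsionPoints_iff {ι : Type} [Fintype ι] (Φ : (ι → ℝ) ≃L[ℝ] ℂ)
    (x : ↥(puncturedTorus Φ)) :
    x ∈ cuspidalTorsionPoints ↥(puncturedTorus Φ) ↔ IsOfFinAddOrder (x : ComplexTorus Φ) :=
  mem_cuspidalTorsionPoints_iff_of localMorphismIsRCHolomorphic_holds Φ x

end HolomorphicEllipticCuspidalization

end Literature.AnabelianGeometry.AbsoluteAnabelian

end
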